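import Mathlib

/-!
# Crux `LinnikCubicClassGroups.PureCubicClassNumberHard` (stmt-QuantumAdvantage-11826) —
# stub `stub_normNeZeta`

Line `Sketch` (honda-leak arm), stub `stub_normNeZeta` (M): the LOCAL OBSTRUCTION at an inert
prime `p ≡ 2, 5 (mod 9)` showing that `ζ = ζ₃` is not a norm `x · σx · σ²x` from the sextic field
`N = ℚ(ζ₃, ∛(pq))`.  Only the following data about `N` are used: a maximal ideal `w` of `𝓞 N`
with `(p) = w³`, residue field of cardinality `p²`, and an automorphism `σ` acting trivially on
`𝓞 N / w`.

Proof.  Suppose `x · σx · σ²x = ζ`.  Write `x = a / n` with `a ∈ 𝓞 N`, `n ∈ ℕ`, `n = pᵏ m`,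
`p ∤ m`; then `a · σa · σ²a = n³ ζ` in `𝓞 N`.  Since `σ(w) = w`, the `w`-adic valuations of
`a, σa, σ²a` agree, so `v_w(a) = v_w(n) = 3k` and `a = pᵏ a'`; cancelling `p^{3k}` gives
`a' · σa' · σ²a' = m³ ζ`.  Modulo `w` (where `σ ≡ id`) this reads `ā'³ = m̄³ ζ̄` with `m̄ ≠ 0`, so
`ζ̄` is a cube in the field `𝓞 N / w` of cardinality `p²`; but `ζ̄³ = 1 ≠ ζ̄` (as `3 ∉ w`), so a
cube root `c` of `ζ̄` satisfies `c⁹ = 1`, `c^{p²-1} = 1`, hence `c^{gcd(9, p²-1)} = c³ = 1`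
because `p² − 1 ≡ 3, 6 (mod 9)` — contradiction.
-/

set_option linter.dupNamespace false -- D-0017: single-problem summit ⇒ QuantumAdvantage.QuantumAdvantage by design

namespace Summit.QuantumAdvantage.QuantumAdvantage.Theorems.LinnikCubicClassGroups

open NumberField IsDedekindDomain

section dedekind

variable {R : Type*} [CommRing R] [IsDedekindDomain R]

/-- Two nonzero elements of a Dedekind domain lying in exactly the same powers of a prime `v`
have the same `v`-adic valuation. [folklore] -/
theorem normNeZeta_intValuation_eq (v : HeightOneSpectrum R) {a b : R} (ha : a ≠ 0)
    (hb : b ≠ 0) (h : ∀ k : ℕ, a ∈ v.asIdeal ^ k ↔ b ∈ v.asIdeal ^ k) :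
    v.intValuation a = v.intValuation b := by
  classical
  set cA := (Associates.mk v.asIdeal).count (Associates.mk (Ideal.span {a})).factors with hcA
  set cB := (Associates.mk v.asIdeal).count (Associates.mk (Ideal.span {b})).factors with hcB
  have h1 := h cA
  have h2 := h cB
  rw [← v.intValuation_le_pow_iff_mem, ← v.intValuation_le_pow_iff_mem] at h1 h2
  rw [v.intValuation_if_neg ha, v.intValuation_if_neg hb] at h1 h2 ⊢
  rw [WithZero.exp_le_exp, WithZero.exp_le_exp] at h1 h2
  rw [WithZero.exp_inj]
  omega

/-- In a Dedekind domain: if `a ≠ 0`, `v(s) = v(a)³` and `s ∈ v^(3j)`, then `a ∈ v^j`.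
[folklore] -/
theorem normNeZeta_mem_pow_of_cube (v : HeightOneSpectrum R) {a s : R} (ha : a ≠ 0)
    (hs : v.intValuation s = v.intValuation a ^ 3) {j : ℕ}
    (hmem : s ∈ v.asIdeal ^ (3 * j)) : a ∈ v.asIdeal ^ j := by
  classical
  rw [← v.intValuation_le_pow_iff_mem] at hmem ⊢
  rw [hs, v.intValuation_if_neg ha] at hmem
  rw [v.intValuation_if_neg ha]
  set c := (Associates.mk v.asIdeal).count (Associates.mk (Ideal.span {a})).factors with hc
  rw [pow_succ, pow_two, ← WithZero.exp_add, ← WithZero.exp_add, WithZero.exp_le_exp] at hmem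
  rw [WithZero.exp_le_exp]
  push_cast at hmem ⊢
  omega

end dedekind

section numberField

variable (N : Type*) [Field N] [NumberField N]

/-- If `σ ≡ id (mod w)` on `𝓞 N`, then `σ` maps `w ^ k` into itself. [folklore] -/
theorem normNeZeta_smul_mem_pow_of (σ : N ≃ₐ[ℚ] N) (w : Ideal (𝓞 N))
    (hσw : ∀ y : 𝓞 N, σ • y - y ∈ w) (k : ℕ) {b : 𝓞 N} (hb : b ∈ w ^ k) :
    σ • b ∈ w ^ k := by
  set φ := MulSemiringAction.toRingHom (N ≃ₐ[ℚ] N) (𝓞 N) σ with hφ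
  have hle : Ideal.map φ w ≤ w := by
    rw [Ideal.map_le_iff_le_comap]
    intro y hy
    rw [Ideal.mem_comap, MulSemiringAction.toRingHom_apply]
    have := w.add_mem (hσw y) hy
    rwa [sub_add_cancel] at this
  have h1 : φ b ∈ Ideal.map φ (w ^ k) := Ideal.mem_map_of_mem φ hb
  rw [Ideal.map_pow, MulSemiringAction.toRingHom_apply] at h1
  exact Ideal.pow_right_mono hle k h1

/-- If `σ ≡ id (mod w)` on `𝓞 N`, membership in `w ^ k` is `σ`-invariant. [folklore] -/
theorem normNeZeta_smul_mem_pow_iff (σ : N ≃ₐ[ℚ] N) (w : Ideal (𝓞 N))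
    (hσw : ∀ y : 𝓞 N, σ • y - y ∈ w) (k : ℕ) (b : 𝓞 N) :
    b ∈ w ^ k ↔ σ • b ∈ w ^ k := by
  refine ⟨normNeZeta_smul_mem_pow_of N σ w hσw k, fun h => ?_⟩
  have hσ' : ∀ y : 𝓞 N, σ⁻¹ • y - y ∈ w := fun y => by
    have := hσw (σ⁻¹ • y)
    rw [smul_inv_smul] at this
    rw [← neg_sub]
    exact w.neg_mem this
  have := normNeZeta_smul_mem_pow_of N σ⁻¹ w hσ' k h
  rwa [inv_smul_smul] at this

end numberField

/-- In a finite field with `p²` elements, `p ≡ 2, 5 (mod 9)`, a nontrivial cube root of unity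
is not a cube (because `9 ∤ p² - 1`). [folklore] -/
theorem normNeZeta_not_cube {F : Type*} [Field F] [Fintype F] {p : ℕ}
    (hp9 : p % 9 = 2 ∨ p % 9 = 5) (hcard : Fintype.card F = p ^ 2) {z c : F}
    (hz3 : z ^ 3 = 1) (hz1 : z ≠ 1) (hc : c ^ 3 = z) : False := by
  have hc0 : c ≠ 0 := by
    rintro rfl
    rw [← hc] at hz3
    norm_num at hz3
  have h9 : c ^ 9 = 1 := by
    rw [show 9 = 3 * 3 by norm_num, pow_mul, hc, hz3]
  have hq : c ^ (p ^ 2 - 1) = 1 := by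
    rw [← hcard]
    exact FiniteField.pow_card_sub_one_eq_one c hc0
  have hg : c ^ Nat.gcd 9 (p ^ 2 - 1) = 1 := pow_gcd_eq_one.mpr ⟨h9, hq⟩
  have hgcd : Nat.gcd 9 (p ^ 2 - 1) = 3 := by
    have h1 : (p ^ 2 - 1) % 9 = 3 ∨ (p ^ 2 - 1) % 9 = 6 := by
      rcases hp9 with h | h
      · left
        have : p ^ 2 % 9 = 4 := by rw [Nat.pow_mod, h]
        omega
      · right
        have : p ^ 2 % 9 = 7 := by rw [Nat.pow_mod, h]
        omega
    rw [Nat.gcd_rec]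
    rcases h1 with h1 | h1 <;> rw [h1] <;> norm_num
  rw [hgcd, hc] at hg
  exact hz1 hg

/-- **Stub `stub_normNeZeta`** (line `Sketch`, honda-leak arm): `ζ` is not a norm from `N`.
The local obstruction at a prime `w` of `𝓞 N` with `(p) = w³`, `#(𝓞 N / w) = p²`,
`σ ≡ id (mod w)` and `p ≡ 2, 5 (mod 9)`: if `x · σx · σ²x = ζ`, write `x = a / n` with
`a ∈ 𝓞 N`, `n = pᵏ m ∈ ℕ`, `p ∤ m`; comparing `w`-adic valuations (`v(σa) = v(a)`) gives
`a = pᵏ a'`, and then modulo `w`, `ā'³ = m̄³ ζ̄` with `m̄ ≠ 0`, so `ζ̄` — a nontrivial cube root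
of unity as `3 ∉ w` — is a cube in a field with `p²` elements, forcing `9 ∣ p² − 1`, which fails
for `p ≡ 2, 5 (mod 9)`. [folklore] -/
theorem stub_normNeZeta (N : Type) [Field N] [NumberField N] (p : ℕ) (hp : p.Prime)
    (hp9 : p % 9 = 2 ∨ p % 9 = 5) (ζ : N) (hζ : ζ ^ 2 + ζ + 1 = 0) (σ : N ≃ₐ[ℚ] N)
    (w : Ideal (𝓞 N)) [w.IsMaximal] (hpw : Ideal.span {(p : 𝓞 N)} = w ^ 3)
    (hcard : Nat.card (𝓞 N ⧸ w) = p ^ 2) (hσw : ∀ y : 𝓞 N, σ • y - y ∈ w) (x : N) :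
    x * σ x * σ (σ x) ≠ ζ := by
  classical
  intro hx
  have hp3 : p ≠ 3 := by
    rintro rfl
    norm_num at hp9
  have hp0 : (p : 𝓞 N) ≠ 0 := Nat.cast_ne_zero.mpr hp.ne_zero
  have hwmax : w.IsMaximal := ‹_›
  haveI hwp : w.IsPrime := hwmax.isPrime
  -- `p ∈ w`
  have hpw1 : (p : 𝓞 N) ∈ w := by
    have h := Ideal.mem_span_singleton_self (p : 𝓞 N)
    rw [hpw] at h
    exact Ideal.pow_le_self three_ne_zero h
  -- naturals prime to `p` are not in `w`
  have hcopw : ∀ m : ℕ, ¬p ∣ m → (m : 𝓞 N) ∉ w := by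
    intro m hm hmw
    have hcop : IsCoprime ((p : ℤ) : 𝓞 N) ((m : ℤ) : 𝓞 N) :=
      (Nat.isCoprime_iff_coprime.mpr (hp.coprime_iff_not_dvd.mpr hm)).map
        (Int.castRingHom (𝓞 N))
    obtain ⟨u, u', huv⟩ := hcop
    apply hwmax.ne_top
    rw [Ideal.eq_top_iff_one, ← huv]
    push_cast
    exact w.add_mem (w.mul_mem_left _ hpw1) (w.mul_mem_left _ hmw)
  have h3w : (3 : 𝓞 N) ∉ w := by
    have := hcopw 3 (fun h => hp3 ((Nat.prime_dvd_prime_iff_eq hp Nat.prime_three).mp h))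
    exact_mod_cast this
  -- `w ≠ ⊥`
  have hw0 : w ≠ ⊥ := by
    rintro rfl
    rw [← Ideal.zero_eq_bot, zero_pow three_ne_zero, Ideal.zero_eq_bot,
      Ideal.span_singleton_eq_bot] at hpw
    exact hp0 hpw
  let v : HeightOneSpectrum (𝓞 N) := ⟨w, hwp, hw0⟩
  -- the algebraic integer `ζ₀ = ζ`
  have hζ3 : ζ ^ 3 = 1 := by linear_combination (ζ - 1) * hζ
  have hζint : IsIntegral ℤ ζ :=
    IsIntegral.of_pow three_pos (by rw [hζ3]; exact isIntegral_one)
  set ζ₀ : 𝓞 N := ⟨ζ, (mem_integralClosure_iff ℤ N).mpr hζint⟩ with hζ₀def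
  have cζ : (ζ₀ : N) = ζ := rfl
  -- coercion bookkeeping `𝓞 N → N`
  have cmul : ∀ b c : 𝓞 N, ((b * c : 𝓞 N) : N) = (b : N) * c := fun b c =>
    map_mul (algebraMap (𝓞 N) N) b c
  have cpow : ∀ (b : 𝓞 N) (j : ℕ), ((b ^ j : 𝓞 N) : N) = (b : N) ^ j := fun b j =>
    map_pow (algebraMap (𝓞 N) N) b j
  have cnat : ∀ j : ℕ, ((j : 𝓞 N) : N) = (j : N) := fun j => map_natCast (algebraMap (𝓞 N) N) j
  have hζ₀ : ζ₀ ^ 2 + ζ₀ + 1 = 0 := by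
    apply RingOfIntegers.ext
    simp only [map_add, map_pow, map_one, map_zero]
    exact hζ
  have hζ₀3 : ζ₀ ^ 3 = 1 := by linear_combination (ζ₀ - 1) * hζ₀
  -- Step 1: an integral multiple `a = n x`, `n ∈ ℕ`, `n ≠ 0`
  obtain ⟨n, hn0, a, ha⟩ : ∃ n : ℕ, n ≠ 0 ∧ ∃ a : 𝓞 N, (a : N) = n * x := by
    have hxalg : IsAlgebraic ℤ x :=
      (IsFractionRing.isAlgebraic_iff ℤ ℚ N).mpr (Algebra.IsAlgebraic.isAlgebraic x)
    obtain ⟨y, hy0, hy⟩ := hxalg.exists_integral_multiple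
    refine ⟨y.natAbs, Int.natAbs_ne_zero.mpr hy0, ?_⟩
    have hcast : ((y.natAbs : ℕ) : N) = ((y.natAbs : ℤ) : N) := (Int.cast_natCast _).symm
    rcases Int.natAbs_eq y with h | h
    · refine ⟨⟨y • x, (mem_integralClosure_iff ℤ N).mpr hy⟩, ?_⟩
      change y • x = _
      rw [zsmul_eq_mul, hcast, ← h]
    · refine ⟨⟨-(y • x), (mem_integralClosure_iff ℤ N).mpr hy.neg⟩, ?_⟩
      have h' : ((y.natAbs : ℤ)) = -y := by omega
      change -(y • x) = _
      rw [zsmul_eq_mul, hcast, h', Int.cast_neg, neg_mul]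
  have hζne : ζ ≠ 0 := by
    rintro rfl
    norm_num at hζ
  have hx0 : x ≠ 0 := by
    rintro rfl
    rw [zero_mul, zero_mul] at hx
    exact hζne hx.symm
  have ha0 : a ≠ 0 := by
    intro h
    have h' : (a : N) = 0 := by rw [h]; rfl
    rw [ha] at h'
    exact (mul_ne_zero (Nat.cast_ne_zero.mpr hn0) hx0) h'
  -- Step 2: the identity `a · σa · σ²a = n³ ζ₀` in `𝓞 N`
  have hσnat : ∀ m : ℕ, σ • (m : 𝓞 N) = m := fun m => by
    apply RingOfIntegers.ext
    show σ ((m : 𝓞 N) : N) = ((m : 𝓞 N) : N)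
    rw [cnat, map_natCast]
  have key : a * σ • a * σ • σ • a = (n : 𝓞 N) ^ 3 * ζ₀ := by
    apply RingOfIntegers.ext
    have e1 : ((σ • a : 𝓞 N) : N) = σ (a : N) := rfl
    have e2 : ((σ • σ • a : 𝓞 N) : N) = σ (σ (a : N)) := rfl
    rw [cmul, cmul, e1, e2, cmul, cpow, cnat, cζ, ha]
    simp only [map_mul, map_natCast]
    rw [← hx]
    ring
  -- Step 3: `n = pᵏ m` with `p ∤ m`
  obtain ⟨k, m, hpm, hnm⟩ := Nat.exists_eq_pow_mul_and_not_dvd hn0 p hp.one_lt.ne'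
  subst hnm
  -- Step 4: `w`-adic valuations: `v(σ b) = v(b)`, so `v(a σa σ²a) = v(a)³`
  have hval : ∀ b : 𝓞 N, b ≠ 0 → v.intValuation (σ • b) = v.intValuation b := fun b hb =>
    (normNeZeta_intValuation_eq v hb ((smul_ne_zero_iff_ne σ).mpr hb)
      (fun k => normNeZeta_smul_mem_pow_iff N σ w hσw k b)).symm
  have hcube : v.intValuation (a * σ • a * σ • σ • a) = v.intValuation a ^ 3 := by
    rw [map_mul, map_mul, hval _ ((smul_ne_zero_iff_ne σ).mpr ha0), hval _ ha0, pow_succ, pow_two]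
  have hmem : a * σ • a * σ • σ • a ∈ v.asIdeal ^ (3 * (3 * k)) := by
    rw [key]
    show _ ∈ w ^ (3 * (3 * k))
    rw [pow_mul, ← hpw, Ideal.span_singleton_pow]
    apply Ideal.mul_mem_right
    push_cast
    rw [mul_pow, ← pow_mul']
    exact Ideal.mul_mem_right _ _ (Ideal.mem_span_singleton_self _)
  -- Step 5: `a = pᵏ a'` and cancellation of `p^{3k}`
  have ha_mem : a ∈ Ideal.span {(p : 𝓞 N) ^ k} := by
    have := normNeZeta_mem_pow_of_cube v ha0 hcube hmem
    rwa [show v.asIdeal = w from rfl, pow_mul, ← hpw, Ideal.span_singleton_pow] at this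
  obtain ⟨a', rfl⟩ := Ideal.mem_span_singleton'.mp ha_mem
  have hσpk : σ • ((p : 𝓞 N) ^ k) = (p : 𝓞 N) ^ k := by rw [smul_pow', hσnat]
  have key2 : a' * σ • a' * σ • σ • a' = (m : 𝓞 N) ^ 3 * ζ₀ := by
    have hpk0 : ((p : 𝓞 N) ^ k) ^ 3 ≠ 0 := pow_ne_zero _ (pow_ne_zero _ hp0)
    apply mul_left_cancel₀ hpk0
    simp only [smul_mul', hσpk] at key
    push_cast at key
    linear_combination key
  -- Step 6: reduce modulo `w`
  have hmw : (m : 𝓞 N) ∉ w := hcopw m hpm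
  letI : Field (𝓞 N ⧸ w) := Ideal.Quotient.field w
  haveI : Finite (𝓞 N ⧸ w) := Nat.finite_of_card_ne_zero (by rw [hcard]; exact pow_ne_zero 2 hp.ne_zero)
  letI : Fintype (𝓞 N ⧸ w) := Fintype.ofFinite _
  have hcardF : Fintype.card (𝓞 N ⧸ w) = p ^ 2 := by rw [← Nat.card_eq_fintype_card, hcard]
  set π := Ideal.Quotient.mk w with hπ
  have hπσ : ∀ b : 𝓞 N, π (σ • b) = π b := fun b => Ideal.Quotient.eq.mpr (hσw b)
  have hz3 : π ζ₀ ^ 3 = 1 := by rw [← map_pow, hζ₀3, map_one]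
  have hz1 : π ζ₀ ≠ 1 := by
    intro h
    have h1 : ζ₀ - 1 ∈ w := by rw [← Ideal.Quotient.eq, ← hπ, h, map_one]
    have h3 : (3 : 𝓞 N) = -((ζ₀ + 2) * (ζ₀ - 1)) := by linear_combination hζ₀
    exact h3w (h3 ▸ w.neg_mem (w.mul_mem_left _ h1))
  have hm0 : π (m : 𝓞 N) ≠ 0 := fun h => hmw (Ideal.Quotient.eq_zero_iff_mem.mp h)
  have key3 : π a' ^ 3 = π (m : 𝓞 N) ^ 3 * π ζ₀ := by
    have := congrArg π key2
    simp only [map_mul, map_pow, hπσ] at this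
    rw [← this]
    ring
  exact normNeZeta_not_cube hp9 hcardF hz3 hz1 (c := π a' / π (m : 𝓞 N))
    (by rw [div_pow, key3, mul_div_cancel_left₀ _ (pow_ne_zero 3 hm0)])

end Summit.QuantumAdvantage.QuantumAdvantage.Theorems.LinnikCubicClassGroups
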